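import Summits.ResolutionOfSingularities.ResolutionOfSingularities.Theorems.FrobeniusClosingPatchingRelPerfectConeTiltLevelTwo
import Summits.ResolutionOfSingularities.ResolutionOfSingularities.Theorems.FrobeniusClosingPatchingRelPerfectConeDepthTwo
import Summits.ResolutionOfSingularities.ResolutionOfSingularities.Theorems.FrobeniusClosingPatchingRelPerfectCoreRungConeMember
import Literature.AlgebraicGeometry.Resolution.BlowupPointSubalgebra
import HarnessLib

/-!
# Crux `PatchingRelPerfect` (stmt-ResolutionOfSingularities-16161), chain w52 — the first
# NON-GRADED member: `(x₀x₁ + x₂² + x₂x₃²) + 𝔪⁴ ∈ 𝒞`, kernel-checked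

[OURS · L1 W5.2 · rung] Kernel sentence v1.4/v1.6 (iii) of CHAIN.md §4 («NON-GRADED I … bites
already at ℓ = 2 for one-form f = F_e + F_{e+1} with F_{e+1} ∉ (F_e) … undecided by hand») — the
first such member, kernel-checked: `f = x₀x₁ + x₂² + x₂x₃²` (`F₂` the quadric CONE, `F₃ = x₂x₃²
∉ (F₂)`), `I = (f) + 𝔪⁴`, `S` regular local with regular system of parameters `x₀, …, x₃` (every
characteristic, every residue field).  On the vertex chart the residual `K = (q̃ + u e₂, u²)` is
NOT `u`-graded, but the vertex is still weight-two-permissible and the strict transform of `f` on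
`Bl_{z₀}` is the tilted conic `G♯ = G + u'e'₃ ≡ G (mod u')`: the r2c tower of `…ConeDepthTwo.lean`
(companion `(P + 𝔪²)(I + 𝔪²(P + 𝔪²)) · 𝔪`, centres `z₀`, `C̃`, `C̃'`) runs verbatim
(`…ConeTiltCharts.lean`, `…ConeTiltLevelTwo.lean`).  PROVED here:

* level one: `Ft_notMem_span_u`, `isRegular_of_isBlowup_map_I2Qt_of_ne_three`,
  `isRegular_of_isBlowup_map_I2Qt_three`, `isRegular_of_isBlowup_I2QtM`;
* the rung: `companion_coneTilt_sup_pow_four` (`(f) + 𝔪⁴ ∈ 𝒞`, companion `⊇ 𝔪⁷`),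
  `coreRung_coneTilt_sup_pow_four`, `coreRung_fourthPowersPlus_coneTilt` (`(x₀⁴, …, x₃⁴, f)`),
  `coreRung_fourthPowersPlus_coneTilt_of_ringKrullDim`, `atomDimFourBlowupAt_fourthPowersPlus_coneTilt`.

So at exceptional depth two, NON-GRADEDNESS ALONE is not the located obstruction (hand analysis of
the cheapest member `x₀x₁ + x₂² + x₃³`, where maximal contact migrates to the strict transform of
`V(f)`: this seat's HAND-NOTE-nongraded-A2.md, evidence on the crux item).  BC5-type FORMAT evidence;
nothing here is a statement of the manuscript under review.

## References

* The Stacks Project, Tags 080A, 080B, 0804, 07Z3, 0BIQ. [StacksProject]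
* Q. Liu, *Algebraic Geometry and Arithmetic Curves*, OUP 2002, Thm. 8.1.19 (a). [Liu2002]
* H. Matsumura, *Commutative Ring Theory*, CUP 1986, Thms. 14.2, 16.2, 16.3. [Matsumura1987]
-/

-- `Summit.<Summit>.<Sub>.Theorems` with `Sub = Summit` (single-conjunct summit, D-0017)
set_option linter.dupNamespace false

noncomputable section

open CategoryTheory CategoryTheory.Limits AlgebraicGeometry Literature.AlgebraicGeometry.Resolution
open IsLocalRing

namespace Summit.ResolutionOfSingularities.ResolutionOfSingularities.Theorems

namespace ConeRung

universe u


/-! ## Level one over a regular local base -/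

section LevelOneRegular

variable {S : Type u} [CommRing S] [IsRegularLocalRing S] (x : Fin 4 → S)
  (hx : Ideal.span (Set.range x) = IsLocalRing.maximalIdeal S)
  (hd : (IsLocalRing.maximalIdeal S).spanFinrank = 4)

local notation3 "M" => Ideal.span (Set.range x)
local notation3 "I2t" => Ideal.span {x 0 * x 1 + x 2 ^ 2 + x 2 * x 3 ^ 2} ⊔ Ideal.span (Set.range x) ^ 4
local notation3 "PP" => Ideal.span {x 0, x 1, x 2}
local notation3 "QQ2t" => (PP ⊔ M ^ 2) * (I2t ⊔ M ^ 2 * (PP ⊔ M ^ 2))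
/-- the vertex-chart family index `k ↦ castSucc k ≠ 3` -/
local notation3 "jJ3" =>
  (fun k : Fin 3 => (⟨Fin.castSucc k, castSucc_ne_three k⟩ : {j : Fin 4 // j ≠ 3}))

/-! ### `F♯ ∉ (u)` on every chart -/

include hx hd in
/-- **`F♯ = e₀e₁ + e₂² + u e₂e₃² ∉ (u)`** on every Rees chart (`F♯ ≡ F (mod u)` and `F ∉ (u)`,
`F_notMem_span_u`). [cite: StacksProject, Tag 0BIQ] -/
theorem Ft_notMem_span_u (i : Fin 4) :
    chartGen x i 0 * chartGen x i 1 + chartGen x i 2 ^ 2 +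
        chartBase x i (x i) * chartGen x i 2 * chartGen x i 3 ^ 2 ∉ Ideal.span {chartBase x i (x i)} :=
  fun h => F_notMem_span_u x hx hd i (by
    have e : chartGen x i 0 * chartGen x i 1 + chartGen x i 2 ^ 2 =
        (chartGen x i 0 * chartGen x i 1 + chartGen x i 2 ^ 2 +
          chartBase x i (x i) * chartGen x i 2 * chartGen x i 3 ^ 2) -
        (chartGen x i 0 * chartGen x i 1 + chartGen x i 2 ^ 2 +
          chartBase x i (x i) * chartGen x i 2 * chartGen x i 3 ^ 2 -
          (chartGen x i 0 * chartGen x i 1 + chartGen x i 2 ^ 2)) := by ring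
    rw [e]
    exact Ideal.sub_mem _ h (Ft_sub_mem x i))

/-! ### The charts `x₀, x₁, x₂`: the two-step tower for `(u, F♯)` -/

include hx hd in
/-- **On the charts `i = 0, 1, 2` every blow-up of `Spec B_i` along
`(I Q) B_i = u⁵ · (u, F) · ((F) + (u²))` is regular**: `(u, F)` is a weakly regular pair with
regular quotient (`B_i/(u)` a domain, `F ∉ (u)`; `…ConeMemberLevelOne`), so the two-step tower
applies. [cite: Liu2002, Thm. 8.1.19 (a)] [cite: StacksProject, Tag 080A] -/
theorem isRegular_of_isBlowup_map_I2Qt_of_ne_three (i : Fin 4) (hi : i ≠ 3) {Y : Scheme.{u}}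
    {ρ : Y ⟶ Spec (.of (chartRing x i))}
    (hρ : IsBlowup ρ (affineBlowup.idealSheaf ((I2t * QQ2t).map (chartBase x i)))) :
    Scheme.IsRegular Y := by
  haveI := isRegularRing_chart x hx hd i
  haveI := isDomain_residue x hx
  have hqr := isQuasiRegular_regularSystemOfParameters hd x hx
  haveI := isDomain_chartRing_quot_span x i hqr
  set x' : Fin 2 → chartRing x i := Fin.cons (chartBase x i (x i))
    (fun _ : Fin 1 => chartGen x i 0 * chartGen x i 1 + chartGen x i 2 ^ 2 +
      chartBase x i (x i) * chartGen x i 2 * chartGen x i 3 ^ 2) with hx'def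
  have hx' : IsQuasiRegular x' :=
    isQuasiRegular_of_isWeaklyRegular _ (CoreRungTower.isWeaklyRegular_pair_of_notMem
      (reesChartBase_mem_nonZeroDivisors (x i) (Ideal.mem_span_range_self (f := x) (x := i)))
      (Ft_notMem_span_u x hx hd i))
  have hR' : IsRegularRing (chartRing x i ⧸ Ideal.span (Set.range x')) := by
    have h : Ideal.span (Set.range x') = Ideal.span {chartBase x i (x i),
        chartGen x i 0 * chartGen x i 1 + chartGen x i 2 ^ 2} := by
      rw [hx'def, Fin.range_cons (chartBase x i (x i))
        (fun _ : Fin 1 => chartGen x i 0 * chartGen x i 1 + chartGen x i 2 ^ 2 +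
          chartBase x i (x i) * chartGen x i 2 * chartGen x i 3 ^ 2), Set.range_const, span_u_Ft]
    rw [h]
    fin_cases i
    · exact isRegularRing_quot_span_u_F_zero x hx hd
    · exact isRegularRing_quot_span_u_F_one x hx hd
    · exact isRegularRing_quot_span_u_F_two x hx hd
    · exact absurd rfl hi
  have hu5 : chartBase x i (x i) ^ 5 ∈ nonZeroDivisors (chartRing x i) :=
    pow_mem (reesChartBase_mem_nonZeroDivisors (x i)
      (Ideal.mem_span_range_self (f := x) (x := i))) 5
  rw [map_chartBase_I2Qt_of_ne_three x i hi, ← CoreRungTower.towerTwo_eq] at hρ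
  exact CoreRungTower.isRegular_of_isBlowup_span_singleton_mul hu5 _
    (fun Y' ρ' h' => isRegular_of_isBlowup_tower 2 x' (fun _ : Fin 1 => (1 : Fin 2))
      (Function.injective_of_subsingleton _) hx' hR' h') hρ

/-! ### The vertex chart `x₃`: instantiate level two with `A = B₃` -/

include hx hd in
/-- **The vertex chart: every blow-up of `Spec B₃` along `(I Q) B₃ = u⁵ · (L · K) · 𝔫₀` is
regular** — the abstract level two with `A = B₃`, `t = u`, `v_k = e_k`.
[cite: StacksProject, Tag 080A] [cite: Liu2002, Thm. 8.1.19 (a)] -/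
theorem isRegular_of_isBlowup_map_I2Qt_three {Y : Scheme.{u}}
    {ρ : Y ⟶ Spec (.of (chartRing x 3))}
    (hρ : IsBlowup ρ (affineBlowup.idealSheaf ((I2t * QQ2t).map (chartBase x 3)))) :
    Scheme.IsRegular Y := by
  haveI : IsDomain S := isDomain_of_isRegularLocalRing S
  have hqr := isQuasiRegular_regularSystemOfParameters hd x hx
  haveI : IsRegularRing (chartRing x 3) := isRegularRing_chart x hx hd 3
  haveI := isRegularRing_residue x hx
  haveI := isDomain_residue x hx
  have hx3 : x 3 ≠ 0 := (isRsopPart_comp_of_rsop hd x hx id Function.injective_id).ne_zero 3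
  haveI : IsDomain (chartRing x 3) := isDomain_chartRing x 3 hx3
  haveI : IsRegularRing (chartRing x 3 ⧸ Ideal.span (Set.range
      (Fin.cons (chartBase x 3 (x 3)) (fun k : Fin 3 => chartGen x 3 (jJ3 k).1) :
        Fin 4 → chartRing x 3))) :=
    isRegularRing_quot_cons_chartGen x 3 jJ3 hqr
  haveI : IsDomain (chartRing x 3 ⧸ Ideal.span (Set.range
      (Fin.cons (chartBase x 3 (x 3)) (fun k : Fin 3 => chartGen x 3 (jJ3 k).1) :
        Fin 4 → chartRing x 3))) :=
    isDomain_quot_span_range_cc x hx hd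
  haveI : IsDomain (chartRing x 3 ⧸ Ideal.span {chartBase x 3 (x 3)}) :=
    isDomain_chartRing_quot_span x 3 hqr
  have hc : IsQuasiRegular (Fin.cons (chartBase x 3 (x 3))
      (fun k : Fin 3 => chartGen x 3 (jJ3 k).1) : Fin 4 → chartRing x 3) :=
    isQuasiRegular_cons_chartGen x 3 jJ3 hqr jJ3_injective
  have hv : ∀ k : Fin 3, chartGen x 3 (jJ3 k).1 ∉ Ideal.span {chartBase x 3 (x 3)} :=
    fun k => chartGen_notMem_span_u x hx hd 3 _ (castSucc_ne_three k)
  have hFt := F_notMem_span_u x hx hd 3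
  have hreg1 : ∀ (k : Fin 3) (P : Ideal (chartRing x 3 ⧸ Ideal.span {chartBase x 3 (x 3),
      chartGen x 3 0 * chartGen x 3 1 + chartGen x 3 2 ^ 2})) [P.IsPrime],
      Ideal.Quotient.mk _ (chartGen x 3 (Fin.castSucc k)) ∉ P →
        IsRegularLocalRing (Localization.AtPrime P) :=
    fun k P _ hP => isRegularLocalRing_quot_span_u_F_three x hx hd P k hP
  have e1 : chartGen x 3 0 * chartGen x 3 1 + chartGen x 3 2 ^ 2 +
      chartBase x 3 (x 3) * chartGen x 3 2 * chartGen x 3 3 ^ 2 =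
      chartGen x 3 0 * chartGen x 3 1 + chartGen x 3 2 ^ 2 + chartBase x 3 (x 3) * chartGen x 3 2 := by
    rw [show chartGen x 3 3 = 1 from chartGen_self x 3]
    ring
  rw [map_chartBase_I2Qt, e1] at hρ
  have hu5 : chartBase x 3 (x 3) ^ 5 ∈ nonZeroDivisors (chartRing x 3) :=
    pow_mem (reesChartBase_mem_nonZeroDivisors (x 3)
      (Ideal.mem_span_range_self (f := x) (x := 3))) 5
  exact isRegular_of_isBlowup_span_singleton_mul_of_forall hu5 _
    (fun Y' ρ' h' => isRegular_of_isBlowup_LKt_mul_span (chartBase x 3 (x 3))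
      (fun k : Fin 3 => chartGen x 3 (jJ3 k).1) hc hv hFt hreg1 h') hρ

include hx hd in
/-- **Every blowing up of `Spec S` along `I · Q · 𝔪` is regular** — `Bl_𝔪` and the four charts.
[cite: StacksProject, Tag 080A] [cite: Liu2002, Thm. 8.1.19 (a)] -/
theorem isRegular_of_isBlowup_I2QtM {Y : Scheme.{u}} {f : Y ⟶ Spec (.of S)}
    (hf : IsBlowup f (affineBlowup.idealSheaf ((I2t * QQ2t) * M))) : Scheme.IsRegular Y := by
  refine isRegular_of_isBlowup_mul_of_charts x (I2t * QQ2t) (fun i Y' ρ h => ?_) hf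
  by_cases hi : i = 3
  · subst hi
    exact isRegular_of_isBlowup_map_I2Qt_three x hx hd h
  · exact isRegular_of_isBlowup_map_I2Qt_of_ne_three x hx hd i hi h

include hx hd in
/-- **`I = (x₀x₁ + x₂² + x₂x₃²) + 𝔪⁴` is in the companion class `𝒞`** with companion `Q · 𝔪 ⊇ 𝔪⁷`.
[cite: StacksProject, Tag 080A] -/
theorem companion_coneTilt_sup_pow_four :
    ∃ (Q : Ideal S) (m : ℕ), IsLocalRing.maximalIdeal S ^ m ≤ Q ∧
      ∃ (Y : Scheme.{u}) (b : Y ⟶ Spec (.of S)),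
        IsBlowup b (affineBlowup.idealSheaf ((I2t) * Q)) ∧ Scheme.IsRegular Y := by
  obtain ⟨Y, b, hb⟩ := exists_isBlowup (Spec (.of S)) (affineBlowup.idealSheaf ((I2t * QQ2t) * M))
  refine ⟨QQ2t * M, 7, ?_, Y, b, by rwa [← mul_assoc], isRegular_of_isBlowup_I2QtM x hx hd hb⟩
  rw [← hx, show (7 : ℕ) = 2 + (2 + 2) + 1 from rfl, pow_add, pow_add, pow_add, pow_one]
  exact Ideal.mul_mono (Ideal.mul_mono le_sup_right
    ((Ideal.mul_mono le_rfl le_sup_right).trans le_sup_right)) le_rfl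

include hx hd in
/-- **CORE RUNG — the first NON-GRADED member.**  For `S` regular local with regular system of
parameters `x₀, …, x₃` and `I = (x₀x₁ + x₂² + x₂x₃²) + 𝔪⁴`, every blowing up `T = Bl_I Spec S`
carries a non-zero ideal sheaf cosupported in the closed fibre whose blowing up is regular.  Every
characteristic, every residue field. [cite: StacksProject, Tag 080A] [cite: Liu2002, Thm. 8.1.19 (a)] -/
theorem coreRung_coneTilt_sup_pow_four (T : Scheme.{u}) (f : T ⟶ Spec (.of S))
    (hf : IsBlowup f (affineBlowup.idealSheaf
      (Ideal.span {x 0 * x 1 + x 2 ^ 2 + x 2 * x 3 ^ 2} ⊔ IsLocalRing.maximalIdeal S ^ 4))) :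
    ∃ (J : T.IdealSheafData) (T' : Scheme.{u}) (π : T' ⟶ T), J ≠ ⊥ ∧
      (∀ t : T, t ∈ J.support → f.base t = IsLocalRing.closedPoint S) ∧
      IsBlowup π J ∧ Scheme.IsRegular T' := by
  haveI : IsDomain S := isDomain_of_isRegularLocalRing S
  have hx0 : x 0 ≠ 0 := (isRsopPart_comp_of_rsop hd x hx id Function.injective_id).ne_zero 0
  have h𝔪 : IsLocalRing.maximalIdeal S ≠ ⊥ := fun h => hx0 (by
    have := hx.le (Ideal.subset_span (Set.mem_range_self 0)); rw [h] at this
    exact (Submodule.mem_bot S).mp this)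
  have hI : (I2t) ≠ ⊥ := fun h => pow_ne_zero 4 h𝔪 (by
    rw [← hx]; exact eq_bot_iff.mpr (le_sup_right.trans h.le))
  have hQ : IsLocalRing.maximalIdeal S ^ 6 ≤ QQ2t := by
    rw [← hx, show (6 : ℕ) = 2 + (2 + 2) from rfl, pow_add, pow_add]
    exact Ideal.mul_mono le_sup_right ((Ideal.mul_mono le_rfl le_sup_right).trans le_sup_right)
  rw [← hx] at hf
  exact atomConclusion_of_pointBlowup_charts x hx h𝔪 hI hQ (fun i Y' ρ h => by
    by_cases hi : i = 3
    · subst hi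
      exact isRegular_of_isBlowup_map_I2Qt_three x hx hd h
    · exact isRegular_of_isBlowup_map_I2Qt_of_ne_three x hx hd i hi h) T f hf

include hx hd in
/-- **The Frobenius-shaped variant `(x₀⁴, x₁⁴, x₂⁴, x₃⁴, x₀x₁ + x₂² + x₂x₃²)`** — a sup-reduction of
`(f) + 𝔪⁴` (`(xᵢ⁴) · 𝔪¹² = 𝔪¹⁶`). [cite: StacksProject, Tag 080A] [cite: Liu2002, Thm. 8.1.19 (a)] -/
theorem coreRung_fourthPowersPlus_coneTilt (T : Scheme.{u}) (f : T ⟶ Spec (.of S))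
    (hf : IsBlowup f (affineBlowup.idealSheaf
      (Ideal.span (Set.range (fun i : Fin 4 => x i ^ 4) ∪ {x 0 * x 1 + x 2 ^ 2 + x 2 * x 3 ^ 2})))) :
    ∃ (J : T.IdealSheafData) (T' : Scheme.{u}) (π : T' ⟶ T), J ≠ ⊥ ∧
      (∀ t : T, t ∈ J.support → f.base t = IsLocalRing.closedPoint S) ∧
      IsBlowup π J ∧ Scheme.IsRegular T' := by
  haveI : IsDomain S := isDomain_of_isRegularLocalRing S
  have hx0 : x 0 ≠ 0 := (isRsopPart_comp_of_rsop hd x hx id Function.injective_id).ne_zero 0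
  -- the pigeonhole `(xᵢ⁴) · 𝔪¹² = 𝔪¹⁶`
  have hred :
      Ideal.span (Set.range fun i : Fin 4 => x i ^ 4) * (M ^ 4) ^ 3 = (M ^ 4) ^ (3 + 1) := by
    rw [← pow_mul, ← pow_mul, CoreRung.span_powers_mul_pow_eq_pow x rfl (by norm_num)]
  have hle : Ideal.span (Set.range fun i : Fin 4 => x i ^ 4) ≤ M ^ 4 := by
    rw [Ideal.span_le]
    rintro _ ⟨i, rfl⟩
    exact Ideal.pow_mem_pow (Ideal.subset_span (Set.mem_range_self i)) 4
  have hI :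
      Ideal.span {x 0 * x 1 + x 2 ^ 2 + x 2 * x 3 ^ 2} ⊔
        Ideal.span (Set.range fun i : Fin 4 => x i ^ 4) ≠ ⊥ :=
    fun h => pow_ne_zero 4 hx0 ((Submodule.eq_bot_iff _).mp h _
      (Ideal.mem_sup_right (Ideal.subset_span
        (Set.mem_range_self (f := fun i : Fin 4 => x i ^ 4) 0))))
  have hKm : IsLocalRing.maximalIdeal S ^ 4 ≤ I2t := by rw [← hx]; exact le_sup_right
  rw [Ideal.span_union, sup_comm] at hf
  exact coreRung_sup_reduction_of_companion hle hred hI hKm (companion_coneTilt_sup_pow_four x hx hd)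
    T f hf

end LevelOneRegular

/-- **The `TargetR2pt` binder shape** (plan-1's `ChainW52TargetsC.lean`): dimension given as
`ringKrullDim S = 4` with a generating family `x` of length `4`.
[cite: StacksProject, Tag 080A] [cite: Liu2002, Thm. 8.1.19 (a)] -/
theorem coreRung_fourthPowersPlus_coneTilt_of_ringKrullDim {S : Type u} [CommRing S]
    [IsRegularLocalRing S] (x : Fin 4 → S)
    (hx : Ideal.span (Set.range x) = IsLocalRing.maximalIdeal S)
    (hdim : ringKrullDim S = (4 : ℕ)) (T : Scheme.{u}) (f : T ⟶ Spec (.of S))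
    (hf : IsBlowup f (affineBlowup.idealSheaf
      (Ideal.span (Set.range (fun i : Fin 4 => x i ^ 4) ∪ {x 0 * x 1 + x 2 ^ 2 + x 2 * x 3 ^ 2})))) :
    ∃ (J : T.IdealSheafData) (T' : Scheme.{u}) (π : T' ⟶ T), J ≠ ⊥ ∧
      (∀ t : T, t ∈ J.support → f.base t = IsLocalRing.closedPoint S) ∧
      IsBlowup π J ∧ Scheme.IsRegular T' := by
  have hd : (IsLocalRing.maximalIdeal S).spanFinrank = 4 := by
    have h := IsRegularLocalRing.spanFinrank_maximalIdeal (R := S)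
    rw [hdim] at h
    exact_mod_cast h
  exact coreRung_fourthPowersPlus_coneTilt x hx hd T f hf

/-- **The same for `(f) + 𝔪⁴` in the `ringKrullDim` binder shape.** [cite: StacksProject, Tag 080A] -/
theorem coreRung_coneTilt_sup_pow_four_of_ringKrullDim {S : Type u} [CommRing S]
    [IsRegularLocalRing S] (x : Fin 4 → S)
    (hx : Ideal.span (Set.range x) = IsLocalRing.maximalIdeal S)
    (hdim : ringKrullDim S = (4 : ℕ)) (T : Scheme.{u}) (f : T ⟶ Spec (.of S))
    (hf : IsBlowup f (affineBlowup.idealSheaf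
      (Ideal.span {x 0 * x 1 + x 2 ^ 2 + x 2 * x 3 ^ 2} ⊔ IsLocalRing.maximalIdeal S ^ 4))) :
    ∃ (J : T.IdealSheafData) (T' : Scheme.{u}) (π : T' ⟶ T), J ≠ ⊥ ∧
      (∀ t : T, t ∈ J.support → f.base t = IsLocalRing.closedPoint S) ∧
      IsBlowup π J ∧ Scheme.IsRegular T' := by
  have hd : (IsLocalRing.maximalIdeal S).spanFinrank = 4 := by
    have h := IsRegularLocalRing.spanFinrank_maximalIdeal (R := S)
    rw [hdim] at h
    exact_mod_cast h
  exact coreRung_coneTilt_sup_pow_four x hx hd T f hf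

/-- **The registered core's binder shape, restricted to the member** (hypotheses of
`stub_atomDimFourBlowup`; characteristic, completeness, residue field and the off-fibre hypothesis
unused). [cite: StacksProject, Tag 080A] [cite: Liu2002, Thm. 8.1.19 (a)] -/
theorem atomDimFourBlowupAt_fourthPowersPlus_coneTilt (p : ℕ) (_hp : p.Prime) (S : Type) [CommRing S]
    [IsRegularLocalRing S] [CharP S p] [IsAdicComplete (IsLocalRing.maximalIdeal S) S]
    [PerfectField (IsLocalRing.ResidueField S)] (hS : ringKrullDim S = (4 : ℕ))
    (x : Fin 4 → S) (hx : Ideal.span (Set.range x) = IsLocalRing.maximalIdeal S)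
    (T : Scheme.{0}) (f : T ⟶ Spec (.of S))
    (hf : IsBlowup f (affineBlowup.idealSheaf
      (Ideal.span (Set.range (fun j : Fin 4 => x j ^ 4) ∪ {x 0 * x 1 + x 2 ^ 2 + x 2 * x 3 ^ 2}))))
    (_hoff : ∀ t : T, f.base t ≠ IsLocalRing.closedPoint S →
      IsRegularLocalRing (T.presheaf.stalk t)) :
    ∃ (J : T.IdealSheafData) (T' : Scheme.{0}) (π : T' ⟶ T), J ≠ ⊥ ∧
      (∀ t : T, t ∈ J.support → f.base t = IsLocalRing.closedPoint S) ∧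
      IsBlowup π J ∧ Scheme.IsRegular T' :=
  coreRung_fourthPowersPlus_coneTilt_of_ringKrullDim x hx hS T f hf

end ConeRung

end Summit.ResolutionOfSingularities.ResolutionOfSingularities.Theorems

end
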